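import Literature.Barriers.NavierStokesRegularity.LionsExponentSharpnessIteration
import Literature.Analysis.FluidPDE.LuoTitiIteration
import HarnessLib

/-!
# Discharge of `LuoTiti2020_infinitelyMany` (Luo–Titi 2020, Theorem 1, consequence clause)

`LuoTiti2020_infinitelyMany_holds : LuoTiti2020_infinitelyMany` — the consequence clause of
T. Luo, E. S. Titi, Calc. Var. PDE 59 (2020) = arXiv:1808.07595, §1 Theorem 1 ("infinitely many
weak solutions with zero initial data for `1 ≤ θ < 5/4`"), obtained from the in-tree reduction
`LuoTiti2020_infinitelyMany_of_iterationLemma` (this directory, `LionsExponentSharpnessIteration`)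
and the discharge `Torus.LuoTiti2020_iterationLemma_holds` of the Iteration Lemma (§2.1, Lemma 1;
`Analysis/FluidPDE/LuoTitiIteration`, the jet-based realisation of §3 of the paper).

`LionsExponentSharpness_holds : LionsExponentSharpness` — the barrier-catalogue entry of
`LionsExponentSharpness.lean` (J.-L. Lions' exponent `5/4` is sharp for uniqueness of `C⁰_t L²_x`
weak solutions on `𝕋³`), which is `LuoTiti2020_infinitelyMany` by definition
(`lionsExponentSharpness_iff`), hence discharged by the same theorem (appended 2026-08-16,
librarian sweep `libsplit-39`: the catalogue entry was still carried as an unproved fact).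

## References
* T. Luo, E. S. Titi, arXiv:1808.07595, §1 Thm. 1 and §2.1 (proof of Thm. 1 from Lemma 1, p. 4). [`LuoTiti2020`]
-/

namespace Literature.Barriers.NavierStokesRegularity

open Literature.Analysis

/-- **Luo–Titi 2020, Theorem 1, consequence clause — discharged.** [cite: LuoTiti2020, §1 Thm. 1; §2.1 p. 4] -/
theorem LuoTiti2020_infinitelyMany_holds : LuoTiti2020_infinitelyMany :=
  LuoTiti2020_infinitelyMany_of_iterationLemma FluidPDE.Torus.LuoTiti2020_iterationLemma_holds

/-- **Barrier `LionsExponentSharpness` (Luo–Titi 2020: hyperviscous regularisation `ν(-Δ)^θ`,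
`1 ≤ θ < 5/4`, does not restore uniqueness of `C⁰_t L²_x` weak solutions on `𝕋³`) — discharged.**
The catalogue entry is `LuoTiti2020_infinitelyMany` by definition (`lionsExponentSharpness_iff`),
so it holds by `LuoTiti2020_infinitelyMany_holds`; equivalently
`LionsExponentSharpness.of_iterationLemma FluidPDE.Torus.LuoTiti2020_iterationLemma_holds`.
[cite: LuoTiti2020, §1 Thm. 1; §2.1 p. 4] -/
theorem LionsExponentSharpness_holds : LionsExponentSharpness :=
  lionsExponentSharpness_iff.mpr LuoTiti2020_infinitelyMany_holds

end Literature.Barriers.NavierStokesRegularity
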